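import Literature.MathematicalPhysics.QuantumLattice.GrassmannFlowIteration
import Literature.MathematicalPhysics.QuantumLattice.GrassmannKernels
import HarnessLib

/-!
# The defect-covariance step: comparing `effAction (C + D) V` with `effAction C V` through the semigroup, `D = D_near + D_far`

Topic `MathematicalPhysics/QuantumLattice`; continuation of `GrassmannEffectiveAction` (semigroup `effAction_add`).  The algebraic spine of a
two-covariance comparison on ONE Grassmann algebra (the nested two-volume pass of a torus against the decoupled copies of a smaller one; the
decoupled point of a cluster interpolation): for `C' = C + D_n + D_f`,
`effAction C' V = effAction D_n (effAction D_f (effAction C V))` (Salmhofer 1999, (2.106), twice), so that, kernel by kernel at a pinned leg,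
`kernel (effAction C' V) − kernel (effAction C V) = [kernel (effAction D_n W₁) − kernel W₁] + [kernel (effAction D_f W) − kernel W]`
with `W := effAction C V`, `W₁ := effAction D_f W` — a NEAR-IDENTITY step (`GrassmannNearIdentityStep`: `D_n` has small entries and row sums)
plus a FAR-SUPPORTED step (`D_f` lives far from the pin; Polchinski + first moments, route-side `…KLRegimeTwoVolumeFarStep`):

* `effAction_add_add` — the double semigroup identity;
* `kernel_sub'` — kernels are additive (difference form);
* **`sum_norm_kernel_effAction_defect_le_of_split`** — `Σ_{X∈P} ‖kernel (effAction (C + D_n + D_f) V) m X − kernel (effAction C V) m X‖ ≤ B_n + B_f`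
  whenever the near bracket is `≤ B_n` and the far bracket is `≤ B_f` on the same pinned family `P`.

Everything is proved; no definition, no named fact.

## Sources
M. Salmhofer, *Renormalization: An Introduction* (Springer 1999), §2.5 (2.105)–(2.106), §4.3 [`Salmhofer1999`].
-/

noncomputable section

namespace Literature.MathematicalPhysics.QuantumLattice

open GrassmannAlgebra Finset

variable (𝕜 : Type*) [RCLike 𝕜] {Γ : Type*} [Fintype Γ]

/-- **The double semigroup identity**: `effAction (C + D_n + D_f) V = effAction D_n (effAction D_f (effAction C V))` when the two intermediate
partition functions are units. [cite: Salmhofer1999, §2.5.1 (2.106)] -/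
theorem effAction_add_add (C Dn Df : Matrix Γ Γ 𝕜) (V : GrassmannAlgebra 𝕜 Γ) (hZC : IsUnit (effPartitionFn 𝕜 C V))
    (hZf : IsUnit (effPartitionFn 𝕜 Df (effAction 𝕜 C V))) :
    effAction 𝕜 (C + Dn + Df) V = effAction 𝕜 Dn (effAction 𝕜 Df (effAction 𝕜 C V)) := by
  rw [show C + Dn + Df = (Dn + Df) + C by abel, effAction_add 𝕜 (Dn + Df) C V hZC, effAction_add 𝕜 Dn Df _ hZf]

omit [Fintype Γ] in
/-- Kernels of a difference. [cite: Salmhofer1999, §4.3 (4.95)] -/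
theorem kernel_sub' (A B : GrassmannAlgebra 𝕜 Γ) (m : ℕ) (X : Fin m → Γ) :
    kernel 𝕜 (A - B) m X = kernel 𝕜 A m X - kernel 𝕜 B m X := by
  rw [sub_eq_add_neg, kernel_add, ← neg_one_smul 𝕜 B, kernel_smul, neg_one_mul, ← sub_eq_add_neg]

/-- **THE DEFECT STEP SPLITS INTO NEAR + FAR.**  With `W := effAction C V` and `W₁ := effAction D_f W`: if on a family `P` of label strings the near
bracket obeys `Σ_{X∈P} ‖kernel (effAction D_n W₁) m X − kernel W₁ m X‖ ≤ B_n` and the far bracket `Σ_{X∈P} ‖kernel W₁ m X − kernel W m X‖ ≤ B_f`, then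
`Σ_{X∈P} ‖kernel (effAction (C + D_n + D_f) V) m X − kernel (effAction C V) m X‖ ≤ B_n + B_f`. [cite: Salmhofer1999, §2.5.1 (2.106)] -/
theorem sum_norm_kernel_effAction_defect_le_of_split (C Dn Df : Matrix Γ Γ 𝕜) (V : GrassmannAlgebra 𝕜 Γ)
    (hZC : IsUnit (effPartitionFn 𝕜 C V)) (hZf : IsUnit (effPartitionFn 𝕜 Df (effAction 𝕜 C V)))
    {m : ℕ} (P : Finset (Fin m → Γ)) {Bn Bf : ℝ}
    (hnear : ∑ X ∈ P, ‖kernel 𝕜 (effAction 𝕜 Dn (effAction 𝕜 Df (effAction 𝕜 C V))) m X - kernel 𝕜 (effAction 𝕜 Df (effAction 𝕜 C V)) m X‖ ≤ Bn)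
    (hfar : ∑ X ∈ P, ‖kernel 𝕜 (effAction 𝕜 Df (effAction 𝕜 C V)) m X - kernel 𝕜 (effAction 𝕜 C V) m X‖ ≤ Bf) :
    ∑ X ∈ P, ‖kernel 𝕜 (effAction 𝕜 (C + Dn + Df) V) m X - kernel 𝕜 (effAction 𝕜 C V) m X‖ ≤ Bn + Bf := by
  rw [effAction_add_add 𝕜 C Dn Df V hZC hZf]
  calc ∑ X ∈ P, ‖kernel 𝕜 (effAction 𝕜 Dn (effAction 𝕜 Df (effAction 𝕜 C V))) m X - kernel 𝕜 (effAction 𝕜 C V) m X‖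
      ≤ ∑ X ∈ P, (‖kernel 𝕜 (effAction 𝕜 Dn (effAction 𝕜 Df (effAction 𝕜 C V))) m X - kernel 𝕜 (effAction 𝕜 Df (effAction 𝕜 C V)) m X‖ +
          ‖kernel 𝕜 (effAction 𝕜 Df (effAction 𝕜 C V)) m X - kernel 𝕜 (effAction 𝕜 C V) m X‖) :=
        sum_le_sum fun X _ => by
          have h : kernel 𝕜 (effAction 𝕜 Dn (effAction 𝕜 Df (effAction 𝕜 C V))) m X - kernel 𝕜 (effAction 𝕜 C V) m X =
              (kernel 𝕜 (effAction 𝕜 Dn (effAction 𝕜 Df (effAction 𝕜 C V))) m X - kernel 𝕜 (effAction 𝕜 Df (effAction 𝕜 C V)) m X) +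
                (kernel 𝕜 (effAction 𝕜 Df (effAction 𝕜 C V)) m X - kernel 𝕜 (effAction 𝕜 C V) m X) := by ring
          rw [h]; exact norm_add_le _ _
    _ = _ := sum_add_distrib
    _ ≤ Bn + Bf := add_le_add hnear hfar

/-- The intermediate actions are even and have no constant part (so the near/far lemmas apply to them). [cite: Salmhofer1999, §4.3.1 (4.85)] -/
theorem effAction_even_constPart (C : Matrix Γ Γ 𝕜) {V : GrassmannAlgebra 𝕜 Γ} (hV : V ∈ evenPart 𝕜 Γ) (hV0 : constPart 𝕜 V = 0)
    (hZ : IsUnit (effPartitionFn 𝕜 C V)) :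
    effAction 𝕜 C V ∈ evenPart 𝕜 Γ ∧ constPart 𝕜 (effAction 𝕜 C V) = 0 :=
  ⟨effAction_mem_evenPart C hV hV0, constPart_effAction 𝕜 C V hZ⟩

end Literature.MathematicalPhysics.QuantumLattice

end
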